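import Literature.AlgebraicGeometry.Motives.AbelianVarietyInvariantHomRank
import Literature.AlgebraicGeometry.Motives.AbelianVarietyEquivariantIsogenyCharacter
import HarnessLib

/-!
# The support of the `ℓ`-adic character and the ranks it controls:
# `[G : H] · dim B_G = dim B_H` when `χ_ℓ` vanishes off `H`, `|G| · dim B_G = dim X` and
# `|G| · rk Hom_{ℤ_ℓ[G]}(T_ℓ X, T_ℓ Y) = 4 dim X dim Y` for a character of regular type, and the invariance of
# `rk Hom_{ℤ_ℓ[G]}(T_ℓ X, T_ℓ Y)` under equivariant isogenies

For a finite group `G` acting on an abelian variety `X` over a field `K` by `ρ : G → End X`, with norm endomorphisms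
`N_G = Σ_g ρ(g)`, `N_H = Σ_{h ∈ H} ρ(h)` and Kani–Rosen factors `B_G = Im N_G`, `B_H = Im N_H`, and a prime `ℓ` invertible
in `K`, the dimension formula `|H| · 2 dim B_H = Σ_{h ∈ H} χ_ℓ(h)` of the tree
(`card_mul_two_mul_dim_image_norm(G)_eq_sum_trace_tateModuleMap`) turns hypotheses on the SUPPORT of the class function
`χ_ℓ(g) = Tr(ρ(g) | T_ℓ X)` into dimension identities:

* §1 `sum_eq_sum_subgroup_of_forall_not_mem` — `Σ_{g ∈ G} f(g) = Σ_{h ∈ H} f(h)` for `f` vanishing off `H`;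
* §2 **`index_mul_dim_image_normG_eq_dim_image_norm`** — if `χ_ℓ(g) = 0` for all `g ∉ H` then **`[G : H] · dim B_G = dim B_H`**;
  **`card_mul_dim_image_normG_eq_dim`** — if `χ_ℓ(g) = 0` for all `g ≠ 1` (a character of regular type, e.g. `G` permuting
  the factors of `A^{|G|}` simply transitively) then **`|G| · dim B_G = dim X`**; and, with the inner-product formula of
  `Motives/AbelianVarietyEquivariantHomCharacterBound`, **`card_mul_finrank_equivariantTateHom_eq_of_trace_eq_zero`**:
  **`|G| · rk_{ℤ_ℓ} Hom_{ℤ_ℓ[G]}(T_ℓ X, T_ℓ Y) = 4 · dim X · dim Y`** for EVERY `G`-variety `Y` (only `g = 1` contributes to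
  `Σ_g χ_Y(g) χ_X(g⁻¹)`);
* §3 **`finrank_equivariantTateHom_eq_of_isIsogeny_source`** / **`…_target`** — `rk_{ℤ_ℓ} Hom_{ℤ_ℓ[G]}(T_ℓ X, T_ℓ Y)` depends
  on `X` and `Y` only up to EQUIVARIANT isogeny (the characters agree, `Motives/AbelianVarietyEquivariantIsogenyCharacter`,
  and `|G| ≠ 0` in `ℤ_ℓ`);
* §4 the auxiliary prime removed from the Hom-side bounds of `Motives/AbelianVarietyInvariantHomRank` (a prime invertible in
  `K` always exists, the tree's `exists_prime_natCast_ne_zero`): **`finrank_hom_source_invariant_le_four_mul'`**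
  (`rk_ℤ {f : X → Y | ρ(g) ≫ f = f ∀ g} ≤ 4 · dim B_G · dim Y`) and **`finrank_hom_target_invariant_le_four_mul'`**.

Everything is a theorem (no definitions, no named facts).  Scope (stated, not hidden): the vanishing hypotheses are on the
`ℓ`-ADIC traces for the chosen `ℓ` (their independence of `ℓ` is not used or asserted); `B_G`, `B_H` enter through
endomorphisms `N` with `End.of N = Σ ρ(g)`.

## References

* [SerreLinearRepresentations1977] J.-P. Serre, *Linear Representations of Finite Groups*, §2.3–§2.4 (`⟨χ, 1⟩ = dim V^G`,
  the regular representation: `r_G(g) = 0` for `g ≠ 1`, Cor. 1–2 of Prop. 5), §7.2.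
* [MumfordAV1970] D. Mumford, *Abelian Varieties* (1970), §19 Thm. 3 and Cor. 1 (pp. 176–178), Thm. 4 (p. 180).
* [KaniRosen1989] E. Kani, M. Rosen, *Idempotent relations and factors of Jacobians*, Math. Ann. 284 (1989), Thm. B (§3).
* [LangeRodriguez2022] H. Lange, R. E. Rodríguez, *Decomposition of Jacobians by Prym Varieties*, LNM 2310 (2022), §2.9.1
  Prop. 2.9.3 (PDF p. 46), §3.1 (group algebra decomposition).
* [DokchitserEtAl2022] V. Dokchitser, H. Green, A. Konstantinou, A. Morgan, *Parity of ranks of Jacobians of curves*,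
  arXiv:2211.06357, §3 (additive functor lemma, `F = V_ℓ`; isogeny invariance).
* [Milne1986AbelianVarieties] J. S. Milne, *Abelian varieties*, in Cornell–Silverman (1986), Lemma 12.2, Thm. 12.5 (pp. 189–190).
-/

noncomputable section

open CategoryTheory CategoryTheory.Limits
open Literature.RepresentationTheory.FiniteGroups
open Literature.NumberTheory.DiophantineGeometry

universe u

namespace Literature.AlgebraicGeometry.Motives

namespace AbelianVariety

/-! ## §1 Sums of functions supported on a subgroup -/

section Support

/-- `Σ_{g ∈ G} f(g) = Σ_{h ∈ H} f(h)` for a function vanishing off the subgroup `H` (any `Fintype` structure on `H`).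
[cite: SerreLinearRepresentations1977, §2.3] -/
theorem sum_eq_sum_subgroup_of_forall_not_mem {G : Type} [Group G] [Fintype G] {R : Type*} [AddCommMonoid R]
    (f : G → R) (H₀ : Subgroup G) [Fintype H₀] (hf : ∀ g, g ∉ H₀ → f g = 0) :
    ∑ g, f g = ∑ h : H₀, f h := by
  classical
  rw [← Finset.sum_filter_of_ne (s := Finset.univ) (p := (· ∈ H₀)) fun g _ hne ↦ by_contra fun hg ↦ hne (hf g hg)]
  exact Finset.sum_subtype _ (fun x ↦ by simp) f

end Support

/-! ## §2 Characters supported on a subgroup; characters of regular type -/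

section Character

variable {K : Type u} [Field K] (ℓ : ℕ) [Fact ℓ.Prime] {X Y : AbelianVariety K} {G : Type} [Group G] [Fintype G]
  (ρ : G →* End X) (ρY : G →* End Y)

/-- **`[G : H] · dim B_G = dim B_H` when the `ℓ`-adic character vanishes off `H`**: `|G| · 2 dim B_G = Σ_{g ∈ G} χ_ℓ(g)
= Σ_{h ∈ H} χ_ℓ(h) = |H| · 2 dim B_H` and `|G| = [G : H] |H|` (`ℓ` invertible in `K`; `N_G = Σ_g ρ(g)`, `N_H = Σ_h ρ(h)`).
[cite: LangeRodriguez2022, §2.9.1 Prop. 2.9.3 (PDF p. 46)] [cite: DokchitserEtAl2022, §3 (additive functor lemma, `F = V_ℓ`)]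
[cite: SerreLinearRepresentations1977, §2.3] -/
theorem index_mul_dim_image_normG_eq_dim_image_norm {H₀ : Subgroup G} [Fintype H₀] {NG N₀ : X ⟶ X}
    (hNG : End.of NG = ∑ g, ρ g) (hN₀ : End.of N₀ = ∑ h : H₀, ρ h) (hℓ : (ℓ : K) ≠ 0)
    (hχ : ∀ g, g ∉ H₀ → LinearMap.trace ℤ_[ℓ] (X.tateModule ℓ) (tateModuleMap ℓ (End.asHom (ρ g))) = 0) :
    H₀.index * (image NG).dim = (image N₀).dim := by
  have hG := card_mul_two_mul_dim_image_normG_eq_sum_trace_tateModuleMap ℓ ρ hNG hℓ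
  have hH := card_mul_two_mul_dim_image_norm_eq_sum_trace_tateModuleMap ℓ ρ hN₀ hℓ
  rw [sum_eq_sum_subgroup_of_forall_not_mem _ H₀ hχ, ← hH, Nat.cast_inj] at hG
  have hidx : H₀.index * Fintype.card H₀ = Fintype.card G := by
    rw [← Nat.card_eq_fintype_card, Subgroup.index_mul_card, Nat.card_eq_fintype_card]
  rw [← hidx] at hG
  have key : Fintype.card H₀ * 2 * (H₀.index * (image NG).dim) = Fintype.card H₀ * 2 * (image N₀).dim :=
    calc Fintype.card H₀ * 2 * (H₀.index * (image NG).dim)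
        = H₀.index * Fintype.card H₀ * (2 * (image NG).dim) := by ring
      _ = Fintype.card H₀ * (2 * (image N₀).dim) := hG
      _ = Fintype.card H₀ * 2 * (image N₀).dim := by ring
  exact mul_left_cancel₀ (mul_ne_zero Fintype.card_ne_zero two_ne_zero) key

/-- **`|G| · dim B_G = dim X` for an `ℓ`-adic character of regular type** (`χ_ℓ(g) = 0` for all `g ≠ 1`):
`|G| · 2 dim B_G = Σ_g χ_ℓ(g) = χ_ℓ(1) = 2 dim X`. [cite: SerreLinearRepresentations1977, §2.4 (Cor. 1 of Prop. 5: ⟨r_G, 1⟩ = 1)]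
[cite: LangeRodriguez2022, §2.9.1 Prop. 2.9.3 (PDF p. 46)] -/
theorem card_mul_dim_image_normG_eq_dim {NG : X ⟶ X} (hNG : End.of NG = ∑ g, ρ g) (hℓ : (ℓ : K) ≠ 0)
    (hχ : ∀ g : G, g ≠ 1 → LinearMap.trace ℤ_[ℓ] (X.tateModule ℓ) (tateModuleMap ℓ (End.asHom (ρ g))) = 0) :
    Fintype.card G * (image NG).dim = X.dim := by
  have h := card_mul_two_mul_dim_image_normG_eq_sum_trace_tateModuleMap ℓ ρ hNG hℓ
  rw [Finset.sum_eq_single (1 : G) (fun g _ hg ↦ hχ g hg) (fun h1 ↦ absurd (Finset.mem_univ _) h1), map_one ρ,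
    show End.asHom (1 : End X) = 𝟙 X from rfl, trace_tateModuleMap_id_eq_two_mul_dim ℓ X hℓ, Nat.cast_inj] at h
  have h2 : 2 * (Fintype.card G * (image NG).dim) = 2 * X.dim := by rw [← h]; ring
  omega

/-- **`|G| · rk_{ℤ_ℓ} Hom_{ℤ_ℓ[G]}(T_ℓ X, T_ℓ Y) = 4 · dim X · dim Y` for EVERY `G`-variety `Y` when `χ_ℓ^X` is of regular
type** (`χ_ℓ^X(g) = 0` for `g ≠ 1`): in `|G| · rk = Σ_g χ_Y(g) χ_X(g⁻¹)` only `g = 1` survives, contributing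
`χ_Y(1) χ_X(1) = 2 dim Y · 2 dim X`. [cite: SerreLinearRepresentations1977, §2.3–§2.4 (⟨χ, r_G⟩ = χ(1))]
[cite: MumfordAV1970, §19 Thm. 3 (p. 176), Thm. 4 (p. 180)] -/
theorem card_mul_finrank_equivariantTateHom_eq_of_trace_eq_zero (hℓ : (ℓ : K) ≠ 0)
    (hχ : ∀ g : G, g ≠ 1 → LinearMap.trace ℤ_[ℓ] (X.tateModule ℓ) (tateModuleMap ℓ (End.asHom (ρ g))) = 0) :
    Fintype.card G * Module.finrank ℤ_[ℓ]
        (⨅ g : G, LinearMap.eqLocus (LinearMap.llcomp ℤ_[ℓ] _ _ _ (tateModuleMap ℓ (End.asHom (ρY g))))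
          (LinearMap.lcomp ℤ_[ℓ] _ (tateModuleMap ℓ (End.asHom (ρ g)))) :
            Submodule ℤ_[ℓ] (X.tateModule ℓ →ₗ[ℤ_[ℓ]] Y.tateModule ℓ)) =
      4 * X.dim * Y.dim := by
  have h := card_mul_finrank_equivariantTateHom_eq_sum ℓ ρ ρY hℓ
  rw [Finset.sum_eq_single (1 : G) (fun g _ hg ↦ by rw [hχ g⁻¹ (inv_ne_one.2 hg), mul_zero])
      (fun h1 ↦ absurd (Finset.mem_univ _) h1), inv_one, map_one ρY, map_one ρ,
    show End.asHom (1 : End X) = 𝟙 X from rfl, show End.asHom (1 : End Y) = 𝟙 Y from rfl,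
    trace_tateModuleMap_id_eq_two_mul_dim ℓ X hℓ, trace_tateModuleMap_id_eq_two_mul_dim ℓ Y hℓ] at h
  refine Nat.cast_injective (R := ℤ_[ℓ]) ?_
  push_cast at h ⊢
  linear_combination h

end Character

/-! ## §3 `rk Hom_{ℤ_ℓ[G]}(T_ℓ X, T_ℓ Y)` is an invariant of the equivariant isogeny classes of `X` and `Y` -/

section Isogeny

variable {K : Type u} [Field K] (ℓ : ℕ) [Fact ℓ.Prime] {X X' Y Y' : AbelianVariety K} {G : Type} [Group G] [Fintype G]
  (ρX : G →* End X) (ρX' : G →* End X') (ρY : G →* End Y) (ρY' : G →* End Y')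

/-- **`rk_{ℤ_ℓ} Hom_{ℤ_ℓ[G]}(T_ℓ X, T_ℓ Y) = rk_{ℤ_ℓ} Hom_{ℤ_ℓ[G]}(T_ℓ X', T_ℓ Y)` for an EQUIVARIANT isogeny `f : X → X'`**
(`ρ_X(g) ≫ f = f ≫ ρ_{X'}(g)`; `ℓ` invertible in `K`): both sides are `|G|⁻¹ Σ_g χ_Y(g) χ_X(g⁻¹)` and `χ_X = χ_{X'}`.
[cite: DokchitserEtAl2022, §3 (isogeny invariance of `V_ℓ`)] [cite: SerreLinearRepresentations1977, §2.3, §7.2] -/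
theorem finrank_equivariantTateHom_eq_of_isIsogeny_source {f : X ⟶ X'} (hfi : IsIsogeny f)
    (hf : ∀ g : G, End.asHom (ρX g) ≫ f = f ≫ End.asHom (ρX' g)) (hℓ : (ℓ : K) ≠ 0) :
    Module.finrank ℤ_[ℓ]
        (⨅ g : G, LinearMap.eqLocus (LinearMap.llcomp ℤ_[ℓ] _ _ _ (tateModuleMap ℓ (End.asHom (ρY g))))
          (LinearMap.lcomp ℤ_[ℓ] _ (tateModuleMap ℓ (End.asHom (ρX g)))) :
            Submodule ℤ_[ℓ] (X.tateModule ℓ →ₗ[ℤ_[ℓ]] Y.tateModule ℓ)) =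
      Module.finrank ℤ_[ℓ]
        (⨅ g : G, LinearMap.eqLocus (LinearMap.llcomp ℤ_[ℓ] _ _ _ (tateModuleMap ℓ (End.asHom (ρY g))))
          (LinearMap.lcomp ℤ_[ℓ] _ (tateModuleMap ℓ (End.asHom (ρX' g)))) :
            Submodule ℤ_[ℓ] (X'.tateModule ℓ →ₗ[ℤ_[ℓ]] Y.tateModule ℓ)) := by
  have h1 := card_mul_finrank_equivariantTateHom_eq_sum ℓ ρX ρY hℓ
  have h2 := card_mul_finrank_equivariantTateHom_eq_sum ℓ ρX' ρY hℓ
  simp only [trace_tateModuleMap_asHom_eq_of_isIsogeny ℓ ρX ρX' hfi hf hℓ] at h1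
  rw [← h2] at h1
  exact Nat.cast_inj.1 (mul_left_cancel₀ (Nat.cast_ne_zero.2 Fintype.card_ne_zero) h1)

/-- **`rk_{ℤ_ℓ} Hom_{ℤ_ℓ[G]}(T_ℓ X, T_ℓ Y) = rk_{ℤ_ℓ} Hom_{ℤ_ℓ[G]}(T_ℓ X, T_ℓ Y')` for an EQUIVARIANT isogeny `f : Y → Y'`**
(`ℓ` invertible in `K`): `χ_Y = χ_{Y'}`. [cite: DokchitserEtAl2022, §3 (isogeny invariance of `V_ℓ`)] [cite: SerreLinearRepresentations1977, §2.3, §7.2] -/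
theorem finrank_equivariantTateHom_eq_of_isIsogeny_target {f : Y ⟶ Y'} (hfi : IsIsogeny f)
    (hf : ∀ g : G, End.asHom (ρY g) ≫ f = f ≫ End.asHom (ρY' g)) (hℓ : (ℓ : K) ≠ 0) :
    Module.finrank ℤ_[ℓ]
        (⨅ g : G, LinearMap.eqLocus (LinearMap.llcomp ℤ_[ℓ] _ _ _ (tateModuleMap ℓ (End.asHom (ρY g))))
          (LinearMap.lcomp ℤ_[ℓ] _ (tateModuleMap ℓ (End.asHom (ρX g)))) :
            Submodule ℤ_[ℓ] (X.tateModule ℓ →ₗ[ℤ_[ℓ]] Y.tateModule ℓ)) =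
      Module.finrank ℤ_[ℓ]
        (⨅ g : G, LinearMap.eqLocus (LinearMap.llcomp ℤ_[ℓ] _ _ _ (tateModuleMap ℓ (End.asHom (ρY' g))))
          (LinearMap.lcomp ℤ_[ℓ] _ (tateModuleMap ℓ (End.asHom (ρX g)))) :
            Submodule ℤ_[ℓ] (X.tateModule ℓ →ₗ[ℤ_[ℓ]] Y'.tateModule ℓ)) := by
  have h1 := card_mul_finrank_equivariantTateHom_eq_sum ℓ ρX ρY hℓ
  have h2 := card_mul_finrank_equivariantTateHom_eq_sum ℓ ρX ρY' hℓ
  simp only [trace_tateModuleMap_asHom_eq_of_isIsogeny ℓ ρY ρY' hfi hf hℓ] at h1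
  rw [← h2] at h1
  exact Nat.cast_inj.1 (mul_left_cancel₀ (Nat.cast_ne_zero.2 Fintype.card_ne_zero) h1)

end Isogeny

/-! ## §4 The invariant-Hom bounds without an auxiliary prime -/

section PrimeFree

variable {K : Type u} [Field K] {X Y : AbelianVariety K} {G : Type} [Group G] [Fintype G]

/-- **`rk_ℤ {f : X → Y | ρ(g) ≫ f = f ∀ g} ≤ 4 · dim B_G · dim Y`** for a finite group acting on `X` by `ρ`, `N_G = Σ_g ρ(g)`,
`B_G = Im N_G`, and any abelian variety `Y` over any field `K` (a prime invertible in `K` exists and is used internally).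
[cite: MumfordAV1970, §19 Thm. 3 and Cor. 1 (pp. 176–178)] [cite: KaniRosen1989, Thm. B] [cite: LangeRodriguez2022, §2.9.1 Prop. 2.9.3 (PDF p. 46)] -/
theorem finrank_hom_source_invariant_le_four_mul' (ρ : G →* End X) {NG : X ⟶ X} (hNG : End.of NG = ∑ g, ρ g) :
    Module.finrank ℤ (⨅ g : G, LinearMap.eqLocus (Preadditive.leftComp Y (End.asHom (ρ g))).toIntLinearMap LinearMap.id :
        Submodule ℤ (X ⟶ Y)) ≤
      4 * (image NG).dim * Y.dim := by
  obtain ⟨l, hlp, hl⟩ := exists_prime_natCast_ne_zero K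
  haveI : Fact l.Prime := ⟨hlp⟩
  exact finrank_hom_source_invariant_le_four_mul l ρ hNG hl

/-- **`rk_ℤ {f : X → Y | f ≫ ρ'(g) = f ∀ g} ≤ 4 · dim X · dim B'_G`** for a finite group acting on `Y` by `ρ'`,
`N'_G = Σ_g ρ'(g)`, `B'_G = Im N'_G`, any `X`, over any field `K`.
[cite: MumfordAV1970, §19 Thm. 3 and Cor. 1 (pp. 176–178)] [cite: KaniRosen1989, Thm. B] [cite: LangeRodriguez2022, §2.9.1 Prop. 2.9.3 (PDF p. 46)] -/
theorem finrank_hom_target_invariant_le_four_mul' (ρ' : G →* End Y) {NG : Y ⟶ Y} (hNG : End.of NG = ∑ g, ρ' g) :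
    Module.finrank ℤ (⨅ g : G, LinearMap.eqLocus (Preadditive.rightComp X (End.asHom (ρ' g))).toIntLinearMap LinearMap.id :
        Submodule ℤ (X ⟶ Y)) ≤
      4 * X.dim * (image NG).dim := by
  obtain ⟨l, hlp, hl⟩ := exists_prime_natCast_ne_zero K
  haveI : Fact l.Prime := ⟨hlp⟩
  exact finrank_hom_target_invariant_le_four_mul l ρ' hNG hl

end PrimeFree

end AbelianVariety

end Literature.AlgebraicGeometry.Motives
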